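/-
Origin: expansion seat `planner-pub-hodgecm-pv02-g3-0`, handover #12 2026-08-18T06:23:40Z (`HOME/pub-hodgecm-pv02-g3/lean/Pv02g3/PerL34/WedgeAlgebra.lean`, md5 71a73bf2, 94 lines);
landed by the gen-6 packager in gate run 24 as `HodgeCM/PerL34/WedgeAlgebra.lean` (stripped 1 #print/#check/#eval lines).
-/
/-
Origin: planner-pub-hodgecm-pv02-g3-0 (unit pub-hodgecm-pv02-g3, DAG-NODE PROVER #02 gen 3), 2026-08-18.
Proposed tree path: `HodgeCM/PerL34/WedgeAlgebra.lean` (new, additive).  Imports LANDED `HodgeCM.PerL34.Ball` only.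
KERNEL: nothing cited, nothing asserted.
-/
import Summits.HodgeConjecture.HodgeCM.PerL34.Ball_2

/-!
# The wedge algebra behind `SplitHolForms.OrbitSpansDisjoint` (per line class, last step)

For affine `f = f₀x₀ + f₁x₁ + f₂`, `g` on `ℂ²` the form `W(f,g) = f dg − g df` has AFFINE coefficients whose six
coefficients are the Plücker coordinates `fᵢgⱼ − fⱼgᵢ` of `f ∧ g ∈ Λ²(ℂ³)`.  Hence an identity
`W(ℓ, L) = β · W(N₀, N₁)` with `(N₀, N₁, ℓ)` the rows of an invertible `3 × 3` matrix forces `β = 0`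
(wedge with `ℓ`: `0 = β · det`).  We prove this at the coefficient level (`wedge_coeff`) and, via
`affine_eq_zero_on_ball` (an affine function vanishing on the ball is zero), at the function level on the ball for
`s ∈ U(2,1)` (`wedge_on_ball`).
-/

noncomputable section

open Matrix

namespace HodgeCM
namespace PerL34
namespace WedgeAlgebra

open HodgeCM.PerL34.BallModel

/-- **Coefficient form.** Rows `n₀, n₁, ℓ` of a matrix with non-zero determinant, an arbitrary covector
`L : Fin 3 → ℂ` and `β : ℂ`: if the six Plücker identities `ℓᵢ Lⱼ − Lᵢ ℓⱼ = β (n₀ᵢ n₁ⱼ − n₁ᵢ n₀ⱼ)` hold for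
`(i, j) ∈ {(0,1), (2,0), (2,1)}`, then `β = 0`. -/
theorem wedge_coeff (M : Matrix (Fin 3) (Fin 3) ℂ) (hM : M.det ≠ 0) (L : Fin 3 → ℂ) (β : ℂ)
    (e01 : M 2 0 * L 1 - L 0 * M 2 1 = β * (M 0 0 * M 1 1 - M 1 0 * M 0 1))
    (e20 : M 2 2 * L 0 - L 2 * M 2 0 = β * (M 0 2 * M 1 0 - M 1 2 * M 0 0))
    (e21 : M 2 2 * L 1 - L 2 * M 2 1 = β * (M 0 2 * M 1 1 - M 1 2 * M 0 1)) : β = 0 := by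
  have hdet : β * M.det = 0 := by
    rw [Matrix.det_fin_three]
    linear_combination M 2 0 * e21 - M 2 1 * e20 - M 2 2 * e01
  exact (mul_eq_zero.mp hdet).resolve_right hM

/-- A point of the ball on a coordinate axis. -/
def axisPt (i : Fin 2) : Ball := ⟨Pi.single i (1 / 2 : ℂ), by
  fin_cases i <;> norm_num [nsq, Pi.single_apply]⟩

/-- (Ported verbatim from the HodgeCMPerL package; no docstring in the source.) -/
@[simp] theorem axisPt_val (i : Fin 2) : (axisPt i).1 = Pi.single i (1 / 2 : ℂ) := rfl

/-- An affine function vanishing on the ball vanishes identically. -/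
theorem affine_eq_zero_on_ball (a b c : ℂ) (h : ∀ x : Ball, a * x.1 0 + b * x.1 1 + c = 0) :
    a = 0 ∧ b = 0 ∧ c = 0 := by
  have h0 := h x₀
  have h1 := h (axisPt 0)
  have h2 := h (axisPt 1)
  simp only [x₀_val, Pi.zero_apply, mul_zero, zero_add, add_zero] at h0
  simp only [axisPt_val, Pi.single_apply] at h1 h2
  simp only [Fin.isValue, ↓reduceIte, one_ne_zero, zero_ne_one, mul_zero, add_zero, zero_add] at h1 h2
  subst h0
  refine ⟨?_, ?_, rfl⟩
  · simpa using h1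
  · simpa using h2

/-- **Function form on the ball.** For `s ∈ U(2,1)` with rows `N₀, N₁, ℓ` of `W3 s x` (affine in `x`), an affine
`L(x) = L₀x₀ + L₁x₁ + L₂` and `β`: if `ℓ·dL − L·dℓ = β (N₀ dN₁ − N₁ dN₀)` coefficientwise on the ball, then `β = 0`. -/
theorem wedge_on_ball (s : U21) (L : Fin 3 → ℂ) (β : ℂ)
    (h : ∀ (x : Ball) (j : Fin 2),
      W3 s x 2 * L (Fin.castSucc j) - (L 0 * x.1 0 + L 1 * x.1 1 + L 2) * mat s 2 (Fin.castSucc j) =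
        β * (W3 s x 0 * mat s 1 (Fin.castSucc j) - W3 s x 1 * mat s 0 (Fin.castSucc j))) : β = 0 := by
  -- coefficient identities from the two components `j = 0, 1`
  have hc : ∀ j : Fin 2,
      (mat s 2 0 * L (Fin.castSucc j) - L 0 * mat s 2 (Fin.castSucc j) -
          β * (mat s 0 0 * mat s 1 (Fin.castSucc j) - mat s 1 0 * mat s 0 (Fin.castSucc j)) = 0) ∧
      (mat s 2 1 * L (Fin.castSucc j) - L 1 * mat s 2 (Fin.castSucc j) -
          β * (mat s 0 1 * mat s 1 (Fin.castSucc j) - mat s 1 1 * mat s 0 (Fin.castSucc j)) = 0) ∧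
      (mat s 2 2 * L (Fin.castSucc j) - L 2 * mat s 2 (Fin.castSucc j) -
          β * (mat s 0 2 * mat s 1 (Fin.castSucc j) - mat s 1 2 * mat s 0 (Fin.castSucc j)) = 0) := by
    intro j
    refine affine_eq_zero_on_ball _ _ _ fun x => ?_
    have hx := h x j
    simp only [W3_apply] at hx
    linear_combination hx
  obtain ⟨e00, -, e20⟩ := hc 0
  obtain ⟨e01, -, e21⟩ := hc 1
  simp only [Fin.castSucc_zero, Fin.castSucc_one] at e00 e20 e01 e21
  refine wedge_coeff (mat s) (det_mat_ne_zero s) L β ?_ ?_ ?_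
  · linear_combination e01
  · linear_combination e20
  · linear_combination e21

end WedgeAlgebra
end PerL34
end HodgeCM

end

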